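import Summits.QuantumFields.GaugeBoot.WilsonLoopRPMinors
import HarnessLib

/-!
# Gauge-boot: area-power lower bounds for the `W(R×T)` targets from reflection positivity

Cell `pub-gaugeboot` (HOME `run/shared/lean/pub/pub-gaugeboot/`), seat lean1; file 2/2 of the §D
`W(R×T)` packaging (file 1/2 = `WilsonLoopRPMinors`). Written for pub-gaugeboot-loop's WILSON-LOOPS.md
§3(b) ("derived certified lower ends for every W row from the certified u rows by exact arithmetic,
ZERO solves") and its in-SDP minor checks K-W2.

HONEST FRAMING (page 1 of every file of this cell): certified bounds on lattice expectations at
STATED coupling, gauge group, dimension and torus size; NOT a mass gap, NOT a continuum limit,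
NOT a string tension, NOT large `N`. The venture is explicitly NOT Yang–Mills-summit-bearing
(barriers `FixedCouplingUltralocality`, `PerturbativeInvisibility`).

## Content (vocabulary of `Targets`: `plaquetteExpectation`, `wilsonLoopExpectation`, shape (A) windows)

* `plaquetteExpectation_nonneg`: `0 ≤ ⟨ū_P⟩` for `SU(N)`, `D ≥ 2`, `β_std ≥ 0`, every even torus;
* `plaquetteExpectation_pow_le_wilsonLoopExpectation`: **`⟨ū_P⟩^{R T} ≤ ⟨W̄(R×T)⟩`** for `SU(N)`, `N ≥ 1`,
  `D ≥ 2`, `β_std ≥ 0`, on every even torus `(ℤ/L)^D` with `R, T ≤ L`;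
* `PlaquetteWindow.wilsonLoopWindow_pow` (+ `T1.t1w_pow`, `T2.t2w_pow`): a certified plaquette window
  `[a, b]` with `a ≥ 0` yields the DERIVED `W(R×T)` window `[a^{RT}, 1]` in shape (A) with threshold
  `max L₀ (max R T)` — exact arithmetic on the certified endpoint, no further solve;
* the general minors at the target level: `wilsonLoopExpectation_sq_le_even/odd`,
  `wilsonLoopExpectation_nonneg_even/odd`, `wilsonLoopExpectation_comm`, `abs_wilsonLoopExpectation_le_one`.

Everything is a corollary of tree theorems (`gram_wilsonLoop_nonneg_even/odd`, Osterwalder–Seiler 1978 /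
Seiler LNP 159 §2) through `WilsonLoopRPMinors`; no certificate, no loop equation, nothing about `L → ∞`.
-/

noncomputable section

open MeasureTheory
open Literature.MathematicalPhysics.QuantumFieldTheory
open Literature.RepresentationTheory.CompactGroups

namespace Summit.QuantumFields.GaugeBoot

/-! ## The cell's targets: `SU(N)` at standard coupling, orbit averages -/

section Targets

variable {N D : ℕ}

/-- A spatial axis exists for `D ≥ 2`. -/
private theorem exists_ne_zero_fin (hD : 2 ≤ D) : haveI : NeZero D := ⟨by omega⟩; ∃ j : Fin D, j ≠ 0 :=
  ⟨⟨1, by omega⟩, fun h => by simpa using congrArg Fin.val h⟩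

/-- `⟨W̄(R×T)⟩_{SU(N), β_std}` on the torus `(ℤ/L)^D` is the expectation of the rectangle at the origin of
the `(0, j)` plane, any spatial `j` (`OrbitAverages`). -/
theorem wilsonLoopExpectation_eq_origin [NeZero D] (L : ℕ) [NeZero L] (β : ℝ) (R T : ℕ) {j : Fin D}
    (hj : j ≠ 0) :
    wilsonLoopExpectation N D L β R T =
      wilsonExpectation (suRep N) (β / N) (wilsonLoop (suRep N) (0 : Site D L) 0 j R T) :=
  wilsonExpectation_meanWilsonLoop_eq_wilsonLoop (suRep N) (continuous_suRep N) _ R T 0 hj.symm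

/-- `⟨ū_P⟩_{SU(N), β_std}` is the expectation of the `1 × 1` loop at the origin of the `(0, j)` plane. -/
theorem plaquetteExpectation_eq_origin [NeZero D] (L : ℕ) [NeZero L] (β : ℝ) {j : Fin D} (hj : j ≠ 0) :
    plaquetteExpectation N D L β =
      wilsonExpectation (suRep N) (β / N) (wilsonLoop (suRep N) (0 : Site D L) 0 j 1 1) := by
  rw [wilsonLoop_one_one]
  exact wilsonExpectation_meanPlaquette_eq_plaquetteTrace (suRep N) (continuous_suRep N) _ 0 hj.symm

/-- `|⟨W̄(R×T)⟩| ≤ 1`. -/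
theorem abs_wilsonLoopExpectation_le_one (hD : 2 ≤ D) (L : ℕ) [NeZero L] (β : ℝ) (R T : ℕ) :
    |wilsonLoopExpectation N D L β R T| ≤ 1 := by
  haveI : NeZero D := ⟨by omega⟩
  obtain ⟨j, hj⟩ := exists_ne_zero_fin hD
  rw [wilsonLoopExpectation_eq_origin L β R T hj]
  exact abs_wilsonExpectation_wilsonLoop_le_one (suRep N) (continuous_suRep N) _ 0 0 j R T

/-- `⟨W̄(R×T)⟩ = ⟨W̄(T×R)⟩`. -/
theorem wilsonLoopExpectation_comm (hD : 2 ≤ D) (L : ℕ) [NeZero L] (β : ℝ) (R T : ℕ) :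
    wilsonLoopExpectation N D L β R T = wilsonLoopExpectation N D L β T R := by
  haveI : NeZero D := ⟨by omega⟩
  obtain ⟨j, hj⟩ := exists_ne_zero_fin hD
  rw [wilsonLoopExpectation_eq_origin L β R T hj, wilsonLoopExpectation_eq_origin L β T R hj]
  exact wilsonExpectation_wilsonLoop_comm (continuous_suRep N) _ hj R T

/-- **`0 ≤ ⟨ū_P⟩`** for `SU(N)`, `D ≥ 2`, `β_std ≥ 0`, on every even torus (reflection positivity in the
hyperplanes between sites). -/
theorem plaquetteExpectation_nonneg (hD : 2 ≤ D) (L : ℕ) [NeZero L] (hL : Even L) {β : ℝ}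
    (hβ : 0 ≤ β) : 0 ≤ plaquetteExpectation N D L β := by
  haveI : NeZero D := ⟨by omega⟩
  obtain ⟨j, hj⟩ := exists_ne_zero_fin hD
  rw [plaquetteExpectation_eq_origin L β hj]
  exact wilsonExpectation_wilsonLoop_one_nonneg hL (continuous_suRep N)
    (div_nonneg hβ (Nat.cast_nonneg N)) hj 1

/-- **Area-power lower bound `⟨ū_P⟩^{R T} ≤ ⟨W̄(R×T)⟩`** for `SU(N)` (`N ≥ 1`) lattice gauge theory in
`D ≥ 2` dimensions at standard Wilson coupling `β_std ≥ 0`, on every EVEN torus `(ℤ/L)^D` with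
`R, T ≤ L` (reflection positivity in the site and link hyperplanes: Osterwalder–Seiler 1978, Seiler LNP 159
§2; the tree's `gram_wilsonLoop_nonneg_even/odd`). HONEST FRAMING: an inequality between two lattice
expectations at the stated coupling; no string tension, no limit. -/
theorem plaquetteExpectation_pow_le_wilsonLoopExpectation (hN : 1 ≤ N) (hD : 2 ≤ D) (L : ℕ) [NeZero L]
    (hL : Even L) {β : ℝ} (hβ : 0 ≤ β) {R T : ℕ} (hR : R ≤ L) (hT : T ≤ L) :
    plaquetteExpectation N D L β ^ (R * T) ≤ wilsonLoopExpectation N D L β R T := by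
  haveI : NeZero D := ⟨by omega⟩
  obtain ⟨j, hj⟩ := exists_ne_zero_fin hD
  rw [plaquetteExpectation_eq_origin L β hj, wilsonLoopExpectation_eq_origin L β R T hj]
  exact wilsonExpectation_plaquette_pow_le_wilsonLoop hL (continuous_suRep N) (by omega)
    (div_nonneg hβ (Nat.cast_nonneg N)) hj hR hT

/-- **Derived `W(R×T)` window from a plaquette window** (WILSON-LOOPS.md §3(b), "derived lower ends, zero
solves"): a certified plaquette window `[a, b]` with `a ≥ 0` at `β_std ≥ 0` gives the `W(R×T)` window
`[a^{RT}, 1]` in shape (A) with threshold `max L₀ (max R T)`. The lower end is exact arithmetic on the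
certified rational `a`; the upper end is the a-priori bound. -/
theorem PlaquetteWindow.wilsonLoopWindow_pow {L₀ : ℕ} {β a b : ℝ} (h : PlaquetteWindow N D L₀ β a b)
    (hN : 1 ≤ N) (hD : 2 ≤ D) (hβ : 0 ≤ β) (ha : 0 ≤ a) (R T : ℕ) :
    WilsonLoopWindow N D (max L₀ (max R T)) β R T (a ^ (R * T)) 1 := by
  intro L _ hL hL₀
  have hL₀' : L₀ ≤ L := le_trans (le_max_left _ _) hL₀
  have hR : R ≤ L := le_trans ((le_max_left _ _).trans (le_max_right _ _)) hL₀
  have hT : T ≤ L := le_trans ((le_max_right _ _).trans (le_max_right _ _)) hL₀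
  refine ⟨?_, (abs_le.mp (abs_wilsonLoopExpectation_le_one hD L β R T)).2⟩
  calc a ^ (R * T) ≤ plaquetteExpectation N D L β ^ (R * T) := pow_le_pow_left₀ ha (h L hL hL₀').1 _
    _ ≤ _ := plaquetteExpectation_pow_le_wilsonLoopExpectation hN hD L hL hβ hR hT

/-- The same for the cell `T1 → T1W` (`SU(2)`, `D = 3`). -/
theorem T1.t1w_pow {L₀ : ℕ} {β a b : ℝ} (h : T1 L₀ β a b) (hβ : 0 ≤ β) (ha : 0 ≤ a) (R T : ℕ) :
    T1W (max L₀ (max R T)) β R T (a ^ (R * T)) 1 :=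
  PlaquetteWindow.wilsonLoopWindow_pow h (by norm_num) (by norm_num) hβ ha R T

/-- The same for the cell `T2 → T2W` (`SU(2)`, `D = 4`). -/
theorem T2.t2w_pow {L₀ : ℕ} {β a b : ℝ} (h : T2 L₀ β a b) (hβ : 0 ≤ β) (ha : 0 ≤ a) (R T : ℕ) :
    T2W (max L₀ (max R T)) β R T (a ^ (R * T)) 1 :=
  PlaquetteWindow.wilsonLoopWindow_pow h (by norm_num) (by norm_num) hβ ha R T

/-- **Target-level site minor** (in-SDP check K-W2): `⟨W̄((a+b)×m)⟩² ≤ ⟨W̄(2a×m)⟩ · ⟨W̄(2b×m)⟩` on every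
even torus with `a, b ≤ L/2`, any real `β_std` (e.g. `W̄(2×m) ≥ W̄(1×m)²`, `W̄(4×m)·1 ≥ W̄(2×m)²`). -/
theorem wilsonLoopExpectation_sq_le_even (hD : 2 ≤ D) (L : ℕ) [NeZero L] (hL : Even L) (β : ℝ)
    {a b : ℕ} (ha : a ≤ L / 2) (hb : b ≤ L / 2) (m : ℕ) :
    wilsonLoopExpectation N D L β (a + b) m ^ 2 ≤
      wilsonLoopExpectation N D L β (a + a) m * wilsonLoopExpectation N D L β (b + b) m := by
  haveI : NeZero D := ⟨by omega⟩
  obtain ⟨j, hj⟩ := exists_ne_zero_fin hD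
  simp only [wilsonLoopExpectation_eq_origin L β _ _ hj]
  exact wilsonExpectation_wilsonLoop_sq_le_even hL (continuous_suRep N) _ hj ha hb m

/-- **Target-level link minor** (K-W2): `⟨W̄((a+b+1)×m)⟩² ≤ ⟨W̄((2a+1)×m)⟩ · ⟨W̄((2b+1)×m)⟩` on every
even torus with `a + 1, b + 1 ≤ L/2`, `β_std ≥ 0` (e.g. `W̄(1×m) · W̄(3×m) ≥ W̄(2×m)²`). -/
theorem wilsonLoopExpectation_sq_le_odd (hD : 2 ≤ D) (L : ℕ) [NeZero L] (hL : Even L) {β : ℝ}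
    (hβ : 0 ≤ β) {a b : ℕ} (ha : a + 1 ≤ L / 2) (hb : b + 1 ≤ L / 2) (m : ℕ) :
    wilsonLoopExpectation N D L β (a + b + 1) m ^ 2 ≤
      wilsonLoopExpectation N D L β (a + a + 1) m * wilsonLoopExpectation N D L β (b + b + 1) m := by
  haveI : NeZero D := ⟨by omega⟩
  obtain ⟨j, hj⟩ := exists_ne_zero_fin hD
  simp only [wilsonLoopExpectation_eq_origin L β _ _ hj]
  exact wilsonExpectation_wilsonLoop_sq_le_odd hL (continuous_suRep N)
    (div_nonneg hβ (Nat.cast_nonneg N)) hj ha hb m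

/-- `0 ≤ ⟨W̄(2a×m)⟩` on every even torus with `a ≤ L/2` (any real `β_std`). -/
theorem wilsonLoopExpectation_nonneg_even (hD : 2 ≤ D) (L : ℕ) [NeZero L] (hL : Even L) (β : ℝ)
    {a : ℕ} (ha : a ≤ L / 2) (m : ℕ) : 0 ≤ wilsonLoopExpectation N D L β (a + a) m := by
  haveI : NeZero D := ⟨by omega⟩
  obtain ⟨j, hj⟩ := exists_ne_zero_fin hD
  rw [wilsonLoopExpectation_eq_origin L β _ _ hj]
  exact wilsonExpectation_wilsonLoop_nonneg_even' hL (continuous_suRep N) _ hj ha m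

/-- `0 ≤ ⟨W̄((2a+1)×m)⟩` on every even torus with `a + 1 ≤ L/2`, `β_std ≥ 0`. -/
theorem wilsonLoopExpectation_nonneg_odd (hD : 2 ≤ D) (L : ℕ) [NeZero L] (hL : Even L) {β : ℝ}
    (hβ : 0 ≤ β) {a : ℕ} (ha : a + 1 ≤ L / 2) (m : ℕ) : 0 ≤ wilsonLoopExpectation N D L β (a + a + 1) m := by
  haveI : NeZero D := ⟨by omega⟩
  obtain ⟨j, hj⟩ := exists_ne_zero_fin hD
  rw [wilsonLoopExpectation_eq_origin L β _ _ hj]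
  exact wilsonExpectation_wilsonLoop_nonneg_odd' hL (continuous_suRep N)
    (div_nonneg hβ (Nat.cast_nonneg N)) hj ha m

end Targets

end Summit.QuantumFields.GaugeBoot

end
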